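import Literature.Analysis.FluidPDE.TorusNSMillerCriterion
import Literature.Analysis.FluidPDE.TorusGradientVorticityLp
import HarnessLib

/-!
# Blow-up requires the strain to blow up in every direction; the two-component vorticity
# criterion (Miller 2020 Thm 1.3 / Cor 5.8; Chae–Choe 1999 Thm 1) on `T³`, continuation form

search for candidate a priori estimates; no regularity claim.

Analysis/FluidPDE proof file (theorems only; no definitions, no named facts). Two regularity
criteria of "one direction" type for classical solutions of the unforced Navier–Stokes equations
on `T³`, in the house continuation form of `TorusNSMillerCriterion` / `TorusNSVorticityLsCriterion`
(the periodic twin of the whole-space BKM-class files `ChaeChoeCriterion`,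
`OneDirectionDerivativeCriterionProofs`; Miller's strain-direction criterion is new to the tree):

* **Miller, ARMA 235 (2020), Thm 1.3 = Thm 5.7 ("Blowup requires the strain to blow up in every
  direction") with a FIXED direction, i.e. the special case `v ≡ e_k` of Cor 5.8**: if
  `2/p + 3/q = 2`, `3/2 < q < ∞`, then `‖u(T)‖²_{Ḣ¹} ≤ ‖u⁰‖²_{Ḣ¹} exp(C_q∫₀ᵀ‖S(·,t)e_k‖^p_{L^q})`,
  `S e_k = ½(∂ₖu + ∇uₖ)`; "in particular if `T_max < ∞` then `∫₀^{T_max}‖∂₃u + ∇u₃‖^p_{L^q} = +∞`"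
  (display after Cor 5.8). Here: `Torus.classicalNS_continuation_of_strainColumn_Lq_rpow_integral_le`
  (a continuous majorant `N(t) ≥ ‖S(t)e_k‖_{L^q}` with `∫₀ᵗ N^{2q/(2q−3)} ≤ I` on `[0, T)` gives
  continuation past `T`), from the flux bound `Torus.exists_enstrophyFlux_le_of_strainColumn_Lq_le`.
  The full Thm 1.3 with an arbitrary field of unit vectors `w(t,x)` (continuous majorant
  `Λ ≥ |S w|`) is `Torus.classicalNS_continuation_of_strainDirection_Lq_rpow_integral_le`
  (flux bound `Torus.exists_enstrophyFlux_le_of_strainDirection_Lq_le`; both from the abstract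
  chain `Torus.exists_enstrophyFlux_le_of_detStrain_majorant_Lq_le`).
  PROOF = Miller's (Lemma 5.6 `|λ₂| ≤ |Sv|` for unit `v`, then the middle-eigenvalue argument of
  Thm 5.2: `−4 det S ≤ 2|S|²λ₂⁺`, Hölder, Gagliardo–Nirenberg, Young, Grönwall), with ONE shortcut:
  the composite pointwise inequality `−det S ≤ ½|S|²λ₂⁺ ≤ ½|S|²|S e_k|` (Lemma 5.1 + Lemma 5.6) is
  proved directly as Hadamard's inequality `|det S| ≤ |Sa||Sb||Sw| ≤ ½|S|²_F |S w|` for an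
  orthonormal frame `(a, b, w)` (private `abs_det_le_half_normSq_mul_sqrt_col` /
  `…_mul_norm_mulVec`, via `Orthonormal.exists_orthonormalBasis_extension_of_card_eq`), which
  needs neither the spectral theorem for `S` nor `tr S = 0`; the analytic chain is the one of
  `TorusNSMillerCriterion` verbatim.
* **Chae–Choe, EJDE 1999/05, Thm 1 (two components of the vorticity)**: "if a Leray–Hopf weak
  solution satisfies `ω̃ ∈ L^{α,γ}_T` with `2/α + 3/γ ≤ 2`, `1 < α < ∞`, `3/2 < γ < ∞` … then `v`
  becomes the classical solution on `(0, T]`", `ω̃ = ω₁e₁ + ω₂e₂`. Here on `T³ = UnitAddTorus (Fin 3)`: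
  `Torus.classicalNS_continuation_of_horizontalVorticity_Lq_rpow_integral_le` (majorant
  `N(t) ≥ ‖ω₀(t)‖_{L^q}, ‖ω₁(t)‖_{L^q}`, `3/2 < q < ∞`, `∫₀ᵗN^{2q/(2q−3)} ≤ I` ⇒ continuation).
  PROOF: NOT the printed one (Chae–Choe bound the stretching term through the Biot–Savart kernel,
  (6)–(9)) but Miller's route (thesis 2020 §6, Prop. 6.6 / ARMA 2020 discussion after Cor 5.8: the
  criterion on `∂₃u + ∇u₃` "is equivalent to Chae and Choe's result … for `3/2 < q < +∞`"):
  pointwise `∂₃u − ∇u₃ = (ω₂, −ω₁, 0)` and the periodic Calderón–Zygmund bound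
  `‖∇u₃‖_{L^q} ≤ C(‖ω₁‖_{L^q} + ‖ω₂‖_{L^q})` (`u₃ − ∫u₃ = Δ⁻¹(∂₁ω₂ − ∂₂ω₁)`, Hessian bound
  `Torus.eLpNorm_hessian_le_laplacian_holds_fin3`, exactly as in `TorusGradientVorticityLp`), so
  `‖S e₃‖_{L^q} ≤ C'(‖ω₁‖_{L^q} + ‖ω₂‖_{L^q})` (`BDSV.exists_eLpNorm_strainColumn_le_horizontal_curl`)
  and the first criterion applies.

Scope (faithfulness): classical solutions with mean-zero slices on `[0, T) × T^d`, `card d = 3`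
(the vorticity part on `UnitAddTorus (Fin 3)` only, as `TorusGradientVorticityLp`), `ν > 0`,
unforced (Miller allows a force `f ∈ L²_t L²_x`), `3/2 < q < ∞` (Miller's and Chae–Choe's endpoint
`q = ∞` resp. the small-`L^{3/2}` case are not typed), continuous majorants with bounded primitive
in place of `L^p(0,T; L^q)` membership; constants inexplicit.
-- TODO(general form): Miller's LOCAL criterion (Cor 5.8 with direction fields `v_n(t)` on a
-- measurable partition), forced system, `q = ∞`; Chae–Choe Thm 2 (`∇ṽ ∈ L^{α,γ}`).

## Mathlib / tree search

Reused: `integral_stretching_eq_four_mul_integral_det_strain`,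
`Torus.integral_inner_laplacian_convect_self_eq_neg`, `Torus.integral_rpow_le_interpolate_two_six'`,
`Torus.exists_integral_gradSq_cube_le_laplacianSq_cube`,
`Torus.classicalNS_continuation_of_enstrophyFlux_le` (via `TorusNSMillerCriterion`);
`BDSV.curl`, `BDSV.invLaplacian_curl`, `Torus.invLaplacian_laplacian`,
`Torus.eLpNorm_hessian_le_laplacian_holds_fin3` (via `TorusGradientVorticityLp`); Mathlib
`Matrix.det_fin_three`, `Matrix.det_reindex_self`, `eLpNorm_add_le`,
`MemLp.eLpNorm_eq_integral_rpow_norm`. Tree search (`lean search 'Chae|Kukavica|oneDirection|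
strainColumn'`): in the WHOLE-SPACE Beale–Kato–Majda-class vocabulary (`ℝ³`,
`HasSobolevExtensionPast`) the tree already has Chae–Choe's Theorem 1 by the printed route
(`chaeChoe_two_vorticity_components_criterion`, `ChaeChoeCriterion.lean`, with
`DivCurlLpRowEstimate` / `ChaeChoeStretchingEstimate`) and the Kukavica–Ziane one-direction
criterion `∂₃u ∈ L^p_tL^r_x`, `9/4 ≤ r ≤ 3` (`oneDirectionDerivativeCriterion_holds`); NEW here
are Miller's strain-direction criterion (Thm 1.3 / Cor 5.8, the full range `3/2 < q < ∞`, in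
either vocabulary) and the `T³` continuation-form twin of the two-component criterion, obtained
from it by Miller's route.

## References

* E. Miller, *A regularity criterion for the Navier–Stokes equation involving only the middle
  eigenvalue of the strain tensor*, Arch. Ration. Mech. Anal. 235 (2020) 99–139
  (arXiv:1710.05569): Thm 1.3 = Thm 5.7, Lemma 5.6, Cor 5.8 and the display following it
  (held: paper:arxiv-1710.05569, pp. 6, 19–20 of the text). [Miller2019]
* D. Chae, H.-J. Choe, *Regularity of solutions to the Navier–Stokes equation*, Electron. J.
  Differential Equations 1999 (1999), No. 05, 1–7: Thm 1 (p. 2), proof pp. 3–4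
  (held: paper:w2600726141). [ChaeChoe1999]
* E. Miller, *The Navier–Stokes strain equation with applications to enstrophy growth and global
  regularity*, PhD thesis, Univ. Toronto 2020, Prop. 6.6 and Thm 6.8 (held: paper:w2999963731,
  pp. 48–50).
* A. J. Majda, A. L. Bertozzi, *Vorticity and Incompressible Flow*, CUP 2002, §11.1 (11.9)
  (Calderón–Zygmund `‖∇v‖_{L^p} ≤ C_p‖ω‖_{L^p}`). [MajdaBertozziCUP2002]
-/

noncomputable section

open Set MeasureTheory intervalIntegral Filter Real Matrix
open scoped InnerProductSpace RealInnerProductSpace Topology ENNReal NNReal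

namespace Literature.Analysis.FluidPDE

open Literature.Analysis.FunctionSpaces

variable {d : Type*} [Fintype d] [DecidableEq d]

namespace StrainDirection

/-! ## §1 Hadamard's inequality for `3 × 3` matrices: `|det M| ≤ ½ |M|²_F |M e_k|` -/

/-- `(det M)² ≤ |c₂|² (|c₀|² |c₁|²)` for the columns `cⱼ` of a real `3 × 3` matrix
(`det M = c₂ · (c₀ × c₁)`, Cauchy–Schwarz, Lagrange's identity). [folklore] -/
private theorem det_sq_le_col_two (M : Matrix (Fin 3) (Fin 3) ℝ) :
    M.det ^ 2 ≤ (∑ i, M i 2 ^ 2) * ((∑ i, M i 0 ^ 2) * (∑ i, M i 1 ^ 2)) := by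
  -- the cross product `w = c₀ × c₁`
  set w0 : ℝ := M 1 0 * M 2 1 - M 2 0 * M 1 1 with hw0
  set w1 : ℝ := M 2 0 * M 0 1 - M 0 0 * M 2 1 with hw1
  set w2 : ℝ := M 0 0 * M 1 1 - M 1 0 * M 0 1 with hw2
  have hdet : M.det = M 0 2 * w0 + M 1 2 * w1 + M 2 2 * w2 := by
    rw [Matrix.det_fin_three, hw0, hw1, hw2]
    ring
  -- Cauchy–Schwarz in `ℝ³`
  have hCS : (M 0 2 * w0 + M 1 2 * w1 + M 2 2 * w2) ^ 2 ≤
      (M 0 2 ^ 2 + M 1 2 ^ 2 + M 2 2 ^ 2) * (w0 ^ 2 + w1 ^ 2 + w2 ^ 2) := by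
    nlinarith [sq_nonneg (M 0 2 * w1 - M 1 2 * w0), sq_nonneg (M 0 2 * w2 - M 2 2 * w0),
      sq_nonneg (M 1 2 * w2 - M 2 2 * w1)]
  -- Lagrange: `|c₀ × c₁|² = |c₀|²|c₁|² − (c₀·c₁)² ≤ |c₀|²|c₁|²`
  have hLag : w0 ^ 2 + w1 ^ 2 + w2 ^ 2 ≤
      (M 0 0 ^ 2 + M 1 0 ^ 2 + M 2 0 ^ 2) * (M 0 1 ^ 2 + M 1 1 ^ 2 + M 2 1 ^ 2) := by
    have e : (M 0 0 ^ 2 + M 1 0 ^ 2 + M 2 0 ^ 2) * (M 0 1 ^ 2 + M 1 1 ^ 2 + M 2 1 ^ 2) =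
        w0 ^ 2 + w1 ^ 2 + w2 ^ 2 + (M 0 0 * M 0 1 + M 1 0 * M 1 1 + M 2 0 * M 2 1) ^ 2 := by
      rw [hw0, hw1, hw2]; ring
    rw [e]
    nlinarith [sq_nonneg (M 0 0 * M 0 1 + M 1 0 * M 1 1 + M 2 0 * M 2 1)]
  have h3 : 0 ≤ M 0 2 ^ 2 + M 1 2 ^ 2 + M 2 2 ^ 2 := by positivity
  simp only [Fin.sum_univ_three]
  rw [hdet]
  exact hCS.trans (mul_le_mul_of_nonneg_left hLag h3)

/-- Hadamard for the last column: `|det M| ≤ ½ (∑ᵢⱼ Mᵢⱼ²) √(∑ᵢ Mᵢ₂²)`. [folklore] -/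
private theorem abs_det_le_col_two (M : Matrix (Fin 3) (Fin 3) ℝ) :
    |M.det| ≤ 2⁻¹ * (∑ i, ∑ j, M i j ^ 2) * Real.sqrt (∑ i, M i 2 ^ 2) := by
  set C0 : ℝ := ∑ i, M i 0 ^ 2 with hC0
  set C1 : ℝ := ∑ i, M i 1 ^ 2 with hC1
  set C2 : ℝ := ∑ i, M i 2 ^ 2 with hC2
  have h0 : 0 ≤ C0 := Finset.sum_nonneg fun i _ => sq_nonneg _
  have h1 : 0 ≤ C1 := Finset.sum_nonneg fun i _ => sq_nonneg _
  have h2 : 0 ≤ C2 := Finset.sum_nonneg fun i _ => sq_nonneg _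
  have hF : ∑ i, ∑ j, M i j ^ 2 = C0 + C1 + C2 := by
    rw [Finset.sum_comm]
    simp only [Fin.sum_univ_three, hC0, hC1, hC2]
  have hsq : M.det ^ 2 ≤ (2⁻¹ * (C0 + C1 + C2) * Real.sqrt C2) ^ 2 := by
    have hd := det_sq_le_col_two M
    rw [← hC0, ← hC1, ← hC2] at hd
    have hAM : C0 * C1 ≤ (2⁻¹ * (C0 + C1 + C2)) ^ 2 := by
      nlinarith [sq_nonneg (C0 - C1), mul_nonneg (add_nonneg h0 h1) h2, sq_nonneg C2]
    calc M.det ^ 2 ≤ C2 * (C0 * C1) := hd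
      _ ≤ C2 * (2⁻¹ * (C0 + C1 + C2)) ^ 2 := mul_le_mul_of_nonneg_left hAM h2
      _ = (2⁻¹ * (C0 + C1 + C2) * Real.sqrt C2) ^ 2 := by
          rw [mul_pow (2⁻¹ * (C0 + C1 + C2)), Real.sq_sqrt h2, mul_comm]
  rw [hF]
  have hR : 0 ≤ 2⁻¹ * (C0 + C1 + C2) * Real.sqrt C2 := by positivity
  exact abs_le_of_sq_le_sq' hsq hR |> fun h => abs_le.2 h

/-- **Hadamard's inequality, column form, on an index type of cardinality three**: for a real
matrix `M` and any index `k`, `|det M| ≤ ½ (∑ᵢⱼ Mᵢⱼ²) · √(∑ᵢ M_{ik}²)`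
(`|det M| ≤ ∏ⱼ |M eⱼ|` and `|Me_a||Me_b| ≤ ½(|Me_a|² + |Me_b|²) ≤ ½|M|²_F`). [folklore] -/
private theorem abs_det_le_half_normSq_mul_sqrt_col {n : Type*} [Fintype n] [DecidableEq n]
    (hn : Fintype.card n = 3) (M : Matrix n n ℝ) (k : n) :
    |M.det| ≤ 2⁻¹ * (∑ i, ∑ j, M i j ^ 2) * Real.sqrt (∑ i, M i k ^ 2) := by
  -- reindex to `Fin 3` with `k ↦ 2`
  obtain ⟨e₀⟩ : Nonempty (n ≃ Fin 3) := Fintype.card_eq.1 (by rw [hn, Fintype.card_fin])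
  set e : n ≃ Fin 3 := e₀.trans (Equiv.swap (e₀ k) 2) with he
  have hek : e k = 2 := by simp [he]
  set M' : Matrix (Fin 3) (Fin 3) ℝ := Matrix.reindex e e M with hM'
  have hdet : M'.det = M.det := Matrix.det_reindex_self e M
  have hF : ∑ a, ∑ b, M' a b ^ 2 = ∑ i, ∑ j, M i j ^ 2 := by
    simp only [hM', Matrix.reindex_apply, Matrix.submatrix_apply]
    rw [e.symm.sum_comp (fun i => ∑ b, M i (e.symm b) ^ 2)]
    refine Finset.sum_congr rfl fun i _ => ?_
    exact e.symm.sum_comp (fun j => M i j ^ 2)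
  have hC : ∑ a, M' a 2 ^ 2 = ∑ i, M i k ^ 2 := by
    simp only [hM', Matrix.reindex_apply, Matrix.submatrix_apply]
    rw [← hek, Equiv.symm_apply_apply]
    exact e.symm.sum_comp (fun i => M i k ^ 2)
  rw [← hdet, ← hF, ← hC]
  exact abs_det_le_col_two M'


/-! ## §2 Hölder and Young helpers (as in `TorusNSMillerCriterion`) -/

omit [DecidableEq d] in
/-- Hölder for continuous nonnegative functions on `T^d` with real conjugate exponents. [folklore] -/
private theorem integral_mul_le_rpow₄ {f g : UnitAddTorus d → ℝ} (hf : Continuous f)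
    (hg : Continuous g) (hf0 : ∀ x, 0 ≤ f x) (hg0 : ∀ x, 0 ≤ g x) {p q : ℝ}
    (hpq : p.HolderConjugate q) :
    ∫ x, f x * g x ≤ (∫ x, f x ^ p) ^ (1 / p) * (∫ x, g x ^ q) ^ (1 / q) :=
  integral_mul_le_Lp_mul_Lq_of_nonneg (μ := volume) hpq (ae_of_all _ hf0) (ae_of_all _ hg0)
    (hf.memLp_of_hasCompactSupport (HasCompactSupport.of_compactSpace f))
    (hg.memLp_of_hasCompactSupport (HasCompactSupport.of_compactSpace g))

omit [Fintype d] [DecidableEq d] in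
/-- The Young/AM–GM absorption: for `ν > 0`, weights `α, β > 0` with `α + β = 1` and
`M, G, P ≥ 0`, `−νP + M G^α P^β ≤ α (M^{1/α} ν^{−β/α}) G`. [folklore] -/
private theorem flux_amgm₄ {ν α β M G P : ℝ} (hν : 0 < ν) (hα0 : 0 < α) (hβ0 : 0 < β)
    (hαβ : α + β = 1) (hM0 : 0 ≤ M) (hG0 : 0 ≤ G) (hP0 : 0 ≤ P) :
    -ν * P + M * G ^ α * P ^ β ≤ α * (M ^ α⁻¹ * (ν ^ (β / α))⁻¹) * G := by
  set X : ℝ := M ^ α⁻¹ * (ν ^ (β / α))⁻¹ * G with hX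
  set Y : ℝ := ν * P with hY
  have hX0 : 0 ≤ X := by positivity
  have hY0 : 0 ≤ Y := by positivity
  have hAMGM := Real.geom_mean_le_arith_mean2_weighted hα0.le hβ0.le hX0 hY0 hαβ
  have hXα : X ^ α = M * (ν ^ β)⁻¹ * G ^ α := by
    rw [hX, Real.mul_rpow (by positivity) hG0, Real.mul_rpow (by positivity) (by positivity),
      Real.inv_rpow (by positivity), ← Real.rpow_mul hν.le, Real.rpow_inv_rpow hM0 hα0.ne']
    congr 2
    rw [div_mul_cancel₀ β hα0.ne']
  have hYβ : Y ^ β = ν ^ β * P ^ β := by rw [hY, Real.mul_rpow hν.le hP0]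
  have hprod : X ^ α * Y ^ β = M * G ^ α * P ^ β := by
    rw [hXα, hYβ]
    have hνβ : (ν ^ β)⁻¹ * ν ^ β = 1 := inv_mul_cancel₀ (Real.rpow_pos_of_pos hν β).ne'
    calc M * (ν ^ β)⁻¹ * G ^ α * (ν ^ β * P ^ β)
        = M * ((ν ^ β)⁻¹ * ν ^ β) * G ^ α * P ^ β := by ring
      _ = M * G ^ α * P ^ β := by rw [hνβ, mul_one]
  rw [hprod] at hAMGM
  have hβ1 : β ≤ 1 := by linarith
  have hβY : β * Y ≤ Y := mul_le_of_le_one_left hY0 hβ1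
  have hXdef : α * X = α * (M ^ α⁻¹ * (ν ^ (β / α))⁻¹) * G := by rw [hX]; ring
  rw [← hXdef]
  linarith

/-- The real inner product on `EuclideanSpace ℝ ι` as a coordinate sum. [folklore] -/
private theorem inner_eq_sum {ι : Type*} [Fintype ι] (x y : EuclideanSpace ℝ ι) :
    ⟪x, y⟫ = ∑ k, x k * y k := by
  simp only [PiLp.inner_apply, RCLike.inner_apply, conj_trivial]
  exact Finset.sum_congr rfl fun k _ => mul_comm _ _

/-- Hadamard in a direction: `|det M| ≤ ½ (∑ᵢⱼ Mᵢⱼ²) |M w|` for a unit vector `w ∈ ℝ³`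
(complete `w` to an orthonormal basis, i.e. an orthogonal `R` with `R e₂ = w`; then
`|det (MR)| = |det M|`, `|MR|_F = |M|_F`, and the last column of `MR` is `Mw`). [folklore] -/
private theorem abs_det_le_dir_fin (M : Matrix (Fin 3) (Fin 3) ℝ) (w : EuclideanSpace ℝ (Fin 3))
    (hw : ‖w‖ = 1) :
    |M.det| ≤ 2⁻¹ * (∑ i, ∑ j, M i j ^ 2) * Real.sqrt (∑ i, (∑ j, M i j * w j) ^ 2) := by
  -- an orthonormal basis `b` of `ℝ³` with `b 2 = w`
  have hon : Orthonormal ℝ (({2} : Set (Fin 3)).restrict fun _ : Fin 3 => w) := by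
    rw [orthonormal_iff_ite]
    rintro ⟨i, hi⟩ ⟨j, hj⟩
    have hi2 : i = 2 := hi
    have hj2 : j = 2 := hj
    subst hi2
    subst hj2
    simp only [Set.restrict_apply, real_inner_self_eq_norm_sq, hw, one_pow, if_true]
  obtain ⟨b, hb⟩ := hon.exists_orthonormalBasis_extension_of_card_eq
    (by rw [finrank_euclideanSpace, Fintype.card_fin])
  have hb2 : b 2 = w := hb 2 rfl
  -- the orthogonal matrix with columns `b j`
  set R : Matrix (Fin 3) (Fin 3) ℝ := Matrix.of fun i j => b j i with hR
  have hbb : ∀ i j : Fin 3, ∑ k, b i k * b j k = if i = j then 1 else 0 := by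
    intro i j
    have h := (orthonormal_iff_ite.1 b.orthonormal) i j
    rw [inner_eq_sum] at h
    exact h
  have hRR : Rᵀ * R = 1 := by
    ext i j
    simp only [Matrix.mul_apply, Matrix.transpose_apply, hR, Matrix.of_apply, Matrix.one_apply]
    exact hbb i j
  have hdetR : R.det ^ 2 = 1 := by
    have h := congr_arg Matrix.det hRR
    rw [Matrix.det_mul, Matrix.det_transpose, Matrix.det_one] at h
    nlinarith [h]
  set M' : Matrix (Fin 3) (Fin 3) ℝ := M * R with hM'
  have hdet : |M'.det| = |M.det| := by
    have h1 : M'.det ^ 2 = M.det ^ 2 := by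
      rw [hM', Matrix.det_mul, mul_pow, hdetR, mul_one]
    rw [← Real.sqrt_sq_eq_abs, ← Real.sqrt_sq_eq_abs, h1]
  -- Parseval in each row: `∑ᵢⱼ M'ᵢⱼ² = ∑ᵢⱼ Mᵢⱼ²`
  have hF : ∑ i, ∑ j, M' i j ^ 2 = ∑ i, ∑ j, M i j ^ 2 := by
    refine Finset.sum_congr rfl fun i _ => ?_
    set r : EuclideanSpace ℝ (Fin 3) := WithLp.toLp 2 (M i) with hr
    have hrk : ∀ k, r k = M i k := fun k => rfl
    have h1 : ∀ j, M' i j = ⟪r, b j⟫ := by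
      intro j
      rw [inner_eq_sum]
      simp only [hM', Matrix.mul_apply, hR, Matrix.of_apply, hrk]
    have h2 := b.sum_sq_norm_inner_left r
    simp only [Real.norm_eq_abs, sq_abs] at h2
    rw [show ∑ j, M' i j ^ 2 = ∑ j, ⟪r, b j⟫ ^ 2 by simp only [h1], h2, EuclideanSpace.norm_sq_eq]
    exact Finset.sum_congr rfl fun k _ => by rw [Real.norm_eq_abs, sq_abs, hrk]
  -- the last column of `M'` is `M w`
  have hC : ∑ i, M' i 2 ^ 2 = ∑ i, (∑ j, M i j * w j) ^ 2 := by
    refine Finset.sum_congr rfl fun i _ => ?_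
    simp only [hM', Matrix.mul_apply, hR, Matrix.of_apply, hb2]
  rw [← hdet, ← hF, ← hC]
  exact abs_det_le_col_two M'

/-- **Hadamard's inequality in a direction, on an index type of cardinality three**: for a real
matrix `M` and a unit vector `w`, `|det M| ≤ ½ (∑ᵢⱼ Mᵢⱼ²) · √(∑ᵢ (∑ⱼ Mᵢⱼwⱼ)²) = ½|M|²_F |Mw|`.
[folklore] -/
private theorem abs_det_le_half_normSq_mul_norm_mulVec {n : Type*} [Fintype n] [DecidableEq n]
    (hn : Fintype.card n = 3) (M : Matrix n n ℝ) (w : EuclideanSpace ℝ n) (hw : ‖w‖ = 1) :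
    |M.det| ≤ 2⁻¹ * (∑ i, ∑ j, M i j ^ 2) * Real.sqrt (∑ i, (∑ j, M i j * w j) ^ 2) := by
  obtain ⟨e⟩ : Nonempty (n ≃ Fin 3) := Fintype.card_eq.1 (by rw [hn, Fintype.card_fin])
  set M' : Matrix (Fin 3) (Fin 3) ℝ := Matrix.reindex e e M with hM'
  set w' : EuclideanSpace ℝ (Fin 3) := WithLp.toLp 2 fun a => w (e.symm a) with hw'
  have hwa : ∀ a, w' a = w (e.symm a) := fun a => rfl
  have hw'1 : ‖w'‖ = 1 := by
    have h : ‖w'‖ ^ 2 = ‖w‖ ^ 2 := by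
      rw [EuclideanSpace.norm_sq_eq, EuclideanSpace.norm_sq_eq]
      simp only [hwa]
      exact e.symm.sum_comp (fun i => ‖w i‖ ^ 2)
    rw [hw, one_pow] at h
    rw [← Real.sqrt_sq (norm_nonneg w'), h, Real.sqrt_one]
  have hdet : M'.det = M.det := Matrix.det_reindex_self e M
  have hF : ∑ a, ∑ b, M' a b ^ 2 = ∑ i, ∑ j, M i j ^ 2 := by
    simp only [hM', Matrix.reindex_apply, Matrix.submatrix_apply]
    rw [e.symm.sum_comp (fun i => ∑ b, M i (e.symm b) ^ 2)]
    refine Finset.sum_congr rfl fun i _ => ?_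
    exact e.symm.sum_comp (fun j => M i j ^ 2)
  have hC : ∑ a, (∑ b, M' a b * w' b) ^ 2 = ∑ i, (∑ j, M i j * w j) ^ 2 := by
    simp only [hM', Matrix.reindex_apply, Matrix.submatrix_apply, hwa]
    rw [e.symm.sum_comp (fun i => (∑ b, M i (e.symm b) * w (e.symm b)) ^ 2)]
    refine Finset.sum_congr rfl fun i _ => ?_
    rw [e.symm.sum_comp (fun j => M i j * w j)]
  rw [← hdet, ← hF, ← hC]
  exact abs_det_le_dir_fin M' w' hw'1

end StrainDirection

open StrainDirection

/-! ## §3 Pointwise: `−4 det S ≤ 2 L |∇v|²` when `|S e_k| ≤ L` -/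

/-- **Miller's Lemma 5.6 composed with Lemma 5.1, column form**: at a point `x`, for the strain
`S(x) = ½((∂ⱼv)ᵢ + (∂ᵢv)ⱼ)` of a field `v` on `T^d`, `card d = 3`, and an index `k` with
`|S(x)e_k| = √(∑ᵢ S(x)ᵢₖ²) ≤ L`: `−4 det S(x) ≤ 2 L ∑ᵢⱼ S(x)ᵢⱼ² ≤ 2 L ∑ⱼ‖∂ⱼv(x)‖²`
(Miller: `−det S ≤ ½|S|²λ₂⁺` (Lemma 5.1) and `|λ₂| ≤ |Sv|` for every unit vector `v`
(Lemma 5.6, "the middle eigenvector is minimal"); here both at once from Hadamard's inequality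
`|det S| ≤ ½|S|²_F|Se_k|`, `StrainDirection.abs_det_le_half_normSq_mul_sqrt_col`, and
`|S|²_F ≤ |∇v|²`). [cite: Miller2019, Lemma 5.6 with Lemma 5.1 (proof of Thm 5.7)] -/
theorem Torus.neg_four_mul_det_strain_le_column_majorant (hd : Fintype.card d = 3)
    {v : UnitAddTorus d → EuclideanSpace ℝ d} (x : UnitAddTorus d) (k : d) {L : ℝ}
    (hL : Real.sqrt (∑ i,
      ((Torus.partialDeriv k v x i + Torus.partialDeriv i v x k) / 2) ^ 2) ≤ L) :
    -4 * (Matrix.of fun i j => (Torus.partialDeriv j v x i + Torus.partialDeriv i v x j) / 2).det ≤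
      2 * L * ∑ j, ‖Torus.partialDeriv j v x‖ ^ 2 := by
  set Sd : Matrix d d ℝ := Matrix.of fun i j =>
    (Torus.partialDeriv j v x i + Torus.partialDeriv i v x j) / 2 with hSd
  have hH := StrainDirection.abs_det_le_half_normSq_mul_sqrt_col hd Sd k
  have hcol : Real.sqrt (∑ i, Sd i k ^ 2) ≤ L := by
    simpa only [hSd, Matrix.of_apply] using hL
  have hF0 : 0 ≤ ∑ i, ∑ j, Sd i j ^ 2 :=
    Finset.sum_nonneg fun i _ => Finset.sum_nonneg fun j _ => sq_nonneg _
  -- `∑ᵢⱼ Sᵢⱼ² ≤ ∑ⱼ ‖∂ⱼv‖²`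
  have hFle : ∑ i, ∑ j, Sd i j ^ 2 ≤ ∑ j, ‖Torus.partialDeriv j v x‖ ^ 2 := by
    have hnorm : ∀ j, ‖Torus.partialDeriv j v x‖ ^ 2 = ∑ i, (Torus.partialDeriv j v x i) ^ 2 := by
      intro j
      rw [EuclideanSpace.norm_sq_eq]
      exact Finset.sum_congr rfl fun i _ => by rw [Real.norm_eq_abs, sq_abs]
    simp only [hnorm, hSd, Matrix.of_apply]
    have key : ∀ i j, ((Torus.partialDeriv j v x i + Torus.partialDeriv i v x j) / 2) ^ 2 ≤
        ((Torus.partialDeriv j v x i) ^ 2 + (Torus.partialDeriv i v x j) ^ 2) / 2 := by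
      intro i j
      nlinarith [sq_nonneg (Torus.partialDeriv j v x i - Torus.partialDeriv i v x j)]
    calc ∑ i, ∑ j, ((Torus.partialDeriv j v x i + Torus.partialDeriv i v x j) / 2) ^ 2
        ≤ ∑ i, ∑ j, ((Torus.partialDeriv j v x i) ^ 2 + (Torus.partialDeriv i v x j) ^ 2) / 2 :=
          Finset.sum_le_sum fun i _ => Finset.sum_le_sum fun j _ => key i j
      _ = ∑ j, ∑ i, (Torus.partialDeriv j v x i) ^ 2 := by
          have hc : ∑ i, ∑ j, (Torus.partialDeriv i v x j) ^ 2 =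
              ∑ i, ∑ j, (Torus.partialDeriv j v x i) ^ 2 := Finset.sum_comm
          simp only [Finset.sum_add_distrib, ← Finset.sum_div, add_div]
          rw [hc, Finset.sum_comm]
          ring
  have hG0 : 0 ≤ ∑ j, ‖Torus.partialDeriv j v x‖ ^ 2 := Finset.sum_nonneg fun j _ => sq_nonneg _
  have h1 : |Sd.det| ≤ 2⁻¹ * (∑ j, ‖Torus.partialDeriv j v x‖ ^ 2) * L :=
    hH.trans (mul_le_mul (mul_le_mul_of_nonneg_left hFle (by norm_num)) hcol (Real.sqrt_nonneg _)
      (by positivity))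
  have h2 : -Sd.det ≤ |Sd.det| := neg_le_abs _
  linarith

/-- **Miller's Lemma 5.6 composed with Lemma 5.1, direction form**: at a point `x`, for the strain
`S(x)` of a field `v` on `T^d`, `card d = 3`, and a UNIT vector `w` with
`|S(x)w| = √(∑ᵢ (∑ⱼ S(x)ᵢⱼwⱼ)²) ≤ L`: `−4 det S(x) ≤ 2 L ∑ⱼ‖∂ⱼv(x)‖²` (Miller, Lemma 5.6:
"`|λ₂(x)| ≤ |S(x)v(x)|` almost everywhere" for `|v(x)| = 1`, with Lemma 5.1; here from Hadamard's
inequality in the direction `w`). [cite: Miller2019, Lemma 5.6 with Lemma 5.1 (proof of Thm 5.7)] -/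
theorem Torus.neg_four_mul_det_strain_le_direction_majorant (hd : Fintype.card d = 3)
    {v : UnitAddTorus d → EuclideanSpace ℝ d} (x : UnitAddTorus d) {w : EuclideanSpace ℝ d}
    (hw : ‖w‖ = 1) {L : ℝ}
    (hL : Real.sqrt (∑ i, (∑ j,
      (Torus.partialDeriv j v x i + Torus.partialDeriv i v x j) / 2 * w j) ^ 2) ≤ L) :
    -4 * (Matrix.of fun i j => (Torus.partialDeriv j v x i + Torus.partialDeriv i v x j) / 2).det ≤
      2 * L * ∑ j, ‖Torus.partialDeriv j v x‖ ^ 2 := by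
  set Sd : Matrix d d ℝ := Matrix.of fun i j =>
    (Torus.partialDeriv j v x i + Torus.partialDeriv i v x j) / 2 with hSd
  have hSdij : ∀ i j, Sd i j = (Torus.partialDeriv j v x i + Torus.partialDeriv i v x j) / 2 :=
    fun i j => rfl
  have hH := StrainDirection.abs_det_le_half_normSq_mul_norm_mulVec hd Sd w hw
  have hcol : Real.sqrt (∑ i, (∑ j, Sd i j * w j) ^ 2) ≤ L := by
    have e : (∑ i, (∑ j, Sd i j * w j) ^ 2) = ∑ i, (∑ j,
        (Torus.partialDeriv j v x i + Torus.partialDeriv i v x j) / 2 * w j) ^ 2 :=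
      Finset.sum_congr rfl fun i _ => by
        rw [Finset.sum_congr rfl fun j _ => by rw [hSdij i j]]
    rw [e]
    exact hL
  have hF0 : 0 ≤ ∑ i, ∑ j, Sd i j ^ 2 :=
    Finset.sum_nonneg fun i _ => Finset.sum_nonneg fun j _ => sq_nonneg _
  have hFle : ∑ i, ∑ j, Sd i j ^ 2 ≤ ∑ j, ‖Torus.partialDeriv j v x‖ ^ 2 := by
    have hnorm : ∀ j, ‖Torus.partialDeriv j v x‖ ^ 2 = ∑ i, (Torus.partialDeriv j v x i) ^ 2 := by
      intro j
      rw [EuclideanSpace.norm_sq_eq]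
      exact Finset.sum_congr rfl fun i _ => by rw [Real.norm_eq_abs, sq_abs]
    simp only [hnorm, hSdij]
    have key : ∀ i j, ((Torus.partialDeriv j v x i + Torus.partialDeriv i v x j) / 2) ^ 2 ≤
        ((Torus.partialDeriv j v x i) ^ 2 + (Torus.partialDeriv i v x j) ^ 2) / 2 := by
      intro i j
      nlinarith [sq_nonneg (Torus.partialDeriv j v x i - Torus.partialDeriv i v x j)]
    calc ∑ i, ∑ j, ((Torus.partialDeriv j v x i + Torus.partialDeriv i v x j) / 2) ^ 2
        ≤ ∑ i, ∑ j, ((Torus.partialDeriv j v x i) ^ 2 + (Torus.partialDeriv i v x j) ^ 2) / 2 :=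
          Finset.sum_le_sum fun i _ => Finset.sum_le_sum fun j _ => key i j
      _ = ∑ j, ∑ i, (Torus.partialDeriv j v x i) ^ 2 := by
          have hc : ∑ i, ∑ j, (Torus.partialDeriv i v x j) ^ 2 =
              ∑ i, ∑ j, (Torus.partialDeriv j v x i) ^ 2 := Finset.sum_comm
          simp only [Finset.sum_add_distrib, ← Finset.sum_div, add_div]
          rw [hc, Finset.sum_comm]
          ring
  have hG0 : 0 ≤ ∑ j, ‖Torus.partialDeriv j v x‖ ^ 2 := Finset.sum_nonneg fun j _ => sq_nonneg _
  have hb0 : (0 : ℝ) ≤ 2⁻¹ * ∑ j, ‖Torus.partialDeriv j v x‖ ^ 2 := mul_nonneg (by norm_num) hG0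
  have hsq0 : 0 ≤ Real.sqrt (∑ i, (∑ j, Sd i j * w j) ^ 2) := Real.sqrt_nonneg _
  have hstep : 2⁻¹ * (∑ i, ∑ j, Sd i j ^ 2) * Real.sqrt (∑ i, (∑ j, Sd i j * w j) ^ 2) ≤
      2⁻¹ * (∑ j, ‖Torus.partialDeriv j v x‖ ^ 2) * L :=
    mul_le_mul (mul_le_mul_of_nonneg_left hFle (by norm_num)) hcol hsq0 hb0
  have h1 : |Sd.det| ≤ 2⁻¹ * (∑ j, ‖Torus.partialDeriv j v x‖ ^ 2) * L := hH.trans hstep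
  have h2 : -Sd.det ≤ |Sd.det| := neg_le_abs _
  linarith

/-! ## §4 The enstrophy flux under `‖S e_k‖_{L^q} ≤ N`, `3/2 < q < ∞` -/

/-- **The enstrophy flux under an `L^q` majorant of `−det S / |∇v|²`, `3/2 < q < ∞`** (the
analytic chain of Miller, ARMA 2020, proof of Thm 5.2 — Hölder, interpolation of `L^{2q'}` between
`L²` and `L⁶`, Sobolev, Young — with the pointwise input abstracted): on `T^d`, `card d = 3`, for
`3/2 < q` and `ν > 0` there is `K ≥ 0` such that for every smooth divergence-free `v`, every
continuous `Λ ≥ 0` on `T^d` with `−4 det S(x) ≤ 2Λ(x)∑ⱼ‖∂ⱼv(x)‖²` at every point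
(`S = ½((∂ⱼv)ᵢ + (∂ᵢv)ⱼ)`), and every `N ≥ (∫Λ^q)^{1/q}`:
`−ν‖Δv‖₂² + ∫⟪(v·∇)v, Δv⟫ ≤ K N^{2q/(2q−3)} ‖∇v‖₂²` (recall `∫⟪(v·∇)v, Δv⟫ = −4∫det S`,
`TorusEnstrophyStrainIdentity`). Instances: `Λ = λ₂⁺` (`TorusNSMillerCriterion`), `Λ = |S e_k|`,
`Λ = |S w|` for a unit field `w` (below).
[cite: Miller2019, Thm 5.2 (proof, pp. 16–17) with Thm 5.7] -/
theorem Torus.exists_enstrophyFlux_le_of_detStrain_majorant_Lq_le (hd : Fintype.card d = 3)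
    {q ν : ℝ} (hq : 3 / 2 < q) (hν : 0 < ν) :
    ∃ K : ℝ, 0 ≤ K ∧ ∀ (v : UnitAddTorus d → EuclideanSpace ℝ d), Torus.IsSmooth v →
      Torus.IsDivFree v → ∀ (Λ : UnitAddTorus d → ℝ), Continuous Λ → (∀ x, 0 ≤ Λ x) →
      (∀ x, -4 * (Matrix.of fun i j =>
          (Torus.partialDeriv j v x i + Torus.partialDeriv i v x j) / 2).det ≤
        2 * Λ x * ∑ j, ‖Torus.partialDeriv j v x‖ ^ 2) →
      ∀ N : ℝ, 0 ≤ N → (∫ x, Λ x ^ q) ^ (1 / q) ≤ N →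
        -ν * (∫ x, ‖Torus.laplacian v x‖ ^ 2) + ∫ x, ⟪Torus.convect v v x, Torus.laplacian v x⟫ ≤
          K * N ^ (2 * q / (2 * q - 3)) * Torus.gradNormSq v := by
  obtain ⟨C₆, hC₆0, hC₆⟩ := Torus.exists_integral_gradSq_cube_le_laplacianSq_cube (d := d) hd
  have hq0 : 0 < q := by linarith
  have hq1 : 0 < q - 1 := by linarith
  have h2q3 : 0 < 2 * q - 3 := by linarith
  -- weights and exponents
  set α : ℝ := (2 * q - 3) / (2 * q) with hα
  set β : ℝ := 3 / (2 * q) with hβ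
  set r : ℝ := 2 * q / (2 * q - 3) with hr
  have hα0 : 0 < α := by rw [hα]; positivity
  have hβ0 : 0 < β := by rw [hβ]; positivity
  have hαβ : α + β = 1 := by rw [hα, hβ]; field_simp; ring
  have hαr : α⁻¹ = r := by rw [hα, hr, inv_div]
  set c : ℝ := 2 * C₆ ^ (1 / (2 * q)) with hc
  have hc0 : 0 ≤ c := by positivity
  set K : ℝ := α * (c ^ r * (ν ^ (β / α))⁻¹) with hK
  have hK0 : 0 ≤ K := by positivity
  refine ⟨K, hK0, fun v hv hdiv Λ hΛc hΛ0 hΛ N hN0 hN => ?_⟩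
  -- notation
  set f : UnitAddTorus d → ℝ := fun x => Real.sqrt (∑ j, ‖Torus.partialDeriv j v x‖ ^ 2) with hf
  set θ : UnitAddTorus d → ℝ := fun x => ∑ j, ‖Torus.partialDeriv j v x‖ ^ 2 with hθ
  set G : ℝ := Torus.gradNormSq v with hGdef
  set P : ℝ := ∫ x, ‖Torus.laplacian v x‖ ^ 2 with hPdef
  have hG0 : 0 ≤ G := Torus.gradNormSq_nonneg _
  have hP0 : 0 ≤ P := integral_nonneg fun x => sq_nonneg _
  have hθ0 : ∀ x, 0 ≤ θ x := fun x => Finset.sum_nonneg fun j _ => sq_nonneg _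
  have hDc : ∀ i, Continuous fun x => Torus.partialDeriv i v x :=
    fun i => (hv.partialDeriv i).continuous
  have hθc : Continuous θ := continuous_finsetSum _ fun i _ => ((hDc i).norm).pow 2
  have hfc : Continuous f := Real.continuous_sqrt.comp hθc
  have hf0 : ∀ x, 0 ≤ f x := fun x => Real.sqrt_nonneg _
  have hf2 : ∀ x, f x ^ 2 = θ x := fun x => Real.sq_sqrt (hθ0 x)
  have hG : ∫ x, f x ^ 2 = G := by simp only [hf2, hθ, hGdef, Torus.gradNormSq]
  have hf6 : ∫ x, f x ^ 6 ≤ C₆ * P ^ 3 := by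
    have e : ∀ x, f x ^ 6 = (∑ j, ‖Torus.partialDeriv j v x‖ ^ 2) ^ 3 := fun x => by
      rw [show f x ^ 6 = (f x ^ 2) ^ 3 by ring, hf2]
    simp only [e]
    exact hC₆ v hv
  have hI6 : 0 ≤ ∫ x, f x ^ 6 := integral_nonneg fun x => pow_nonneg (hf0 x) 6
  -- Step 1: the flux equals `-νP - 4∫det S` and `-4 det S ≤ 2 Λ θ` pointwise
  set Sd : UnitAddTorus d → Matrix d d ℝ := fun x => Matrix.of fun i j =>
    (Torus.partialDeriv j v x i + Torus.partialDeriv i v x j) / 2 with hSd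
  have hid : ∫ x, ⟪Torus.convect v v x, Torus.laplacian v x⟫ = -4 * ∫ x, (Sd x).det := by
    have h1 := integral_stretching_eq_four_mul_integral_det_strain hd hv hdiv
    have h2 := Torus.integral_inner_laplacian_convect_self_eq_neg hv hdiv
    have hsymm : ∫ x, ⟪Torus.convect v v x, Torus.laplacian v x⟫ =
        ∫ x, ⟪Torus.laplacian v x, Torus.convect v v x⟫ :=
      integral_congr_ae (ae_of_all _ fun x => real_inner_comm _ _)
    rw [hsymm, h2, h1]
    ring
  have hpt : ∀ x, -4 * (Sd x).det ≤ 2 * (Λ x * θ x) := by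
    intro x
    have h := hΛ x
    simp only [hSd, hθ]
    linarith
  have hSdc : Continuous Sd := by
    refine continuous_matrix fun i j => ?_
    simp only [hSd, Matrix.of_apply]
    exact (((hv.partialDeriv j).apply i).continuous.add
      ((hv.partialDeriv i).apply j).continuous).div_const _
  have hdetI : Integrable (fun x => (Sd x).det) volume := hSdc.matrix_det.integrable_unitAddTorus
  have hΛθI : Integrable (fun x => 2 * (Λ x * θ x)) volume :=
    ((hΛc.mul hθc).integrable_unitAddTorus).const_mul 2
  have hstep1 : ∫ x, ⟪Torus.convect v v x, Torus.laplacian v x⟫ ≤ 2 * ∫ x, Λ x * θ x := by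
    rw [hid, ← MeasureTheory.integral_const_mul, ← MeasureTheory.integral_const_mul]
    exact integral_mono (hdetI.const_mul _) hΛθI hpt
  -- Step 2: Hölder `∫ Λ θ ≤ (∫Λ^q)^{1/q} (∫ θ^{q/(q-1)})^{(q-1)/q}`
  have hpq : q.HolderConjugate (q / (q - 1)) := by
    refine Real.holderConjugate_iff.2 ⟨by linarith, ?_⟩
    field_simp
    ring
  have hH := integral_mul_le_rpow₄ (f := Λ) (g := θ) hΛc hθc hΛ0 hθ0 hpq
  have eθ : ∀ x, θ x ^ (q / (q - 1)) = f x ^ (2 * q / (q - 1)) := fun x => by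
    rw [← hf2 x, show (f x ^ 2 : ℝ) = f x ^ (2 : ℝ) by rw [Real.rpow_two], ← Real.rpow_mul (hf0 x)]
    congr 1; field_simp
  simp only [eθ] at hH
  rw [one_div_div] at hH
  -- Step 3: interpolation with `q̃ = 2q/(q-1) ∈ (2, 6)` and the Sobolev step
  have hq2 : 2 < 2 * q / (q - 1) := by rw [lt_div_iff₀ hq1]; linarith
  have hq6 : 2 * q / (q - 1) < 6 := by rw [div_lt_iff₀ hq1]; linarith
  have hI := Torus.integral_rpow_le_interpolate_two_six' hq2 hq6 hfc hf0
  rw [hG] at hI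
  set Fq : ℝ := ∫ x, f x ^ (2 * q / (q - 1)) with hFq
  have hFq0 : 0 ≤ Fq := integral_nonneg fun x => Real.rpow_nonneg (hf0 x) _
  have x6q : (6 - 2 * q / (q - 1)) / 4 = (2 * q - 3) / (2 * (q - 1)) := by field_simp; ring
  have xq2 : (2 * q / (q - 1) - 2) / 4 = 1 / (2 * (q - 1)) := by field_simp; ring
  rw [x6q, xq2] at hI
  have hFq_le : Fq ^ ((q - 1) / q) ≤ C₆ ^ (1 / (2 * q)) * G ^ α * P ^ β := by
    have h1 : Fq ≤ G ^ ((2 * q - 3) / (2 * (q - 1))) * (C₆ * P ^ 3) ^ (1 / (2 * (q - 1))) := by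
      refine hI.trans (mul_le_mul_of_nonneg_left ?_ (Real.rpow_nonneg hG0 _))
      exact Real.rpow_le_rpow hI6 hf6 (by positivity)
    have h2 := Real.rpow_le_rpow hFq0 h1 (by positivity : (0 : ℝ) ≤ (q - 1) / q)
    refine h2.trans (le_of_eq ?_)
    have hCP : 0 ≤ C₆ * P ^ 3 := by positivity
    rw [Real.mul_rpow (Real.rpow_nonneg hG0 _) (Real.rpow_nonneg hCP _), ← Real.rpow_mul hG0,
      ← Real.rpow_mul hCP, Real.mul_rpow hC₆0 (by positivity),
      show (P ^ 3 : ℝ) = P ^ (3 : ℝ) by norm_cast, ← Real.rpow_mul hP0]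
    have x1 : (2 * q - 3) / (2 * (q - 1)) * ((q - 1) / q) = α := by rw [hα]; field_simp
    have x2 : 1 / (2 * (q - 1)) * ((q - 1) / q) = 1 / (2 * q) := by field_simp
    have x3 : (3 : ℝ) * (1 / (2 * q)) = β := by rw [hβ]; ring
    rw [x1, x2, x3]
    ring
  -- Step 4: `flux ≤ -νP + (c N) G^α P^β`, then AM–GM
  have hT2 : ∫ x, ⟪Torus.convect v v x, Torus.laplacian v x⟫ ≤ (c * N) * G ^ α * P ^ β := by
    refine hstep1.trans ?_
    calc 2 * ∫ x, Λ x * θ x ≤ 2 * ((∫ x, Λ x ^ q) ^ (1 / q) * Fq ^ ((q - 1) / q)) :=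
          mul_le_mul_of_nonneg_left hH (by norm_num)
      _ ≤ 2 * (N * (C₆ ^ (1 / (2 * q)) * G ^ α * P ^ β)) := by
          refine mul_le_mul_of_nonneg_left ?_ (by norm_num)
          exact mul_le_mul hN hFq_le (Real.rpow_nonneg hFq0 _) hN0
      _ = (c * N) * G ^ α * P ^ β := by rw [hc]; ring
  have hM0 : 0 ≤ c * N := mul_nonneg hc0 hN0
  have hmain := flux_amgm₄ hν hα0 hβ0 hαβ hM0 hG0 hP0 (M := c * N)
  have hKX : α * ((c * N) ^ α⁻¹ * (ν ^ (β / α))⁻¹) * G = K * N ^ r * G := by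
    rw [hαr, hK, Real.mul_rpow hc0 hN0]
    ring
  calc -ν * (∫ x, ‖Torus.laplacian v x‖ ^ 2) + ∫ x, ⟪Torus.convect v v x, Torus.laplacian v x⟫
      ≤ -ν * P + (c * N) * G ^ α * P ^ β := by rw [hPdef]; linarith [hT2]
    _ ≤ α * ((c * N) ^ α⁻¹ * (ν ^ (β / α))⁻¹) * G := hmain
    _ = K * N ^ (2 * q / (2 * q - 3)) * Torus.gradNormSq v := by rw [hKX]

/-- **The enstrophy flux under `‖S e_k‖_{L^q} ≤ N`, `3/2 < q < ∞`** (Miller, ARMA 2020, proof of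
Thm 5.7 = Lemma 5.6 + the argument of Thm 5.2): on `T^d`, `card d = 3`, for `3/2 < q` and `ν > 0`
there is `K ≥ 0` such that for every smooth divergence-free `v`, every index `k`, every continuous
`Λ ≥ 0` on `T^d` with `|S(x)e_k| = √(∑ᵢ S(x)ᵢₖ²) ≤ Λ(x)` pointwise, and every `N ≥ (∫Λ^q)^{1/q}`:
`−ν‖Δv‖₂² + ∫⟪(v·∇)v, Δv⟫ ≤ K N^{2q/(2q−3)} ‖∇v‖₂²`
(`Torus.exists_enstrophyFlux_le_of_detStrain_majorant_Lq_le` with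
`Torus.neg_four_mul_det_strain_le_column_majorant`).
[cite: Miller2019, Thm 5.7 (proof: Lemma 5.6 and Thm 5.2, pp. 16–19)] -/
theorem Torus.exists_enstrophyFlux_le_of_strainColumn_Lq_le (hd : Fintype.card d = 3)
    {q ν : ℝ} (hq : 3 / 2 < q) (hν : 0 < ν) :
    ∃ K : ℝ, 0 ≤ K ∧ ∀ (v : UnitAddTorus d → EuclideanSpace ℝ d), Torus.IsSmooth v →
      Torus.IsDivFree v → ∀ (k : d) (Λ : UnitAddTorus d → ℝ), Continuous Λ → (∀ x, 0 ≤ Λ x) →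
      (∀ x, Real.sqrt (∑ i,
        ((Torus.partialDeriv k v x i + Torus.partialDeriv i v x k) / 2) ^ 2) ≤ Λ x) →
      ∀ N : ℝ, 0 ≤ N → (∫ x, Λ x ^ q) ^ (1 / q) ≤ N →
        -ν * (∫ x, ‖Torus.laplacian v x‖ ^ 2) + ∫ x, ⟪Torus.convect v v x, Torus.laplacian v x⟫ ≤
          K * N ^ (2 * q / (2 * q - 3)) * Torus.gradNormSq v := by
  obtain ⟨K, hK0, hK⟩ := Torus.exists_enstrophyFlux_le_of_detStrain_majorant_Lq_le (d := d) hd hq hν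
  exact ⟨K, hK0, fun v hv hdiv k Λ hΛc hΛ0 hΛ N hN0 hN =>
    hK v hv hdiv Λ hΛc hΛ0
      (fun x => Torus.neg_four_mul_det_strain_le_column_majorant hd (v := v) x k (hΛ x)) N hN0 hN⟩

/-- **The enstrophy flux under `‖S w‖_{L^q} ≤ N` for a unit vector field `w`, `3/2 < q < ∞`**
(Miller, ARMA 2020, Thm 5.7, proof: Lemma 5.6 `|λ₂| ≤ |Sv|` + Thm 5.2): as
`Torus.exists_enstrophyFlux_le_of_strainColumn_Lq_le`, with `e_k` replaced by any field of unit
vectors `w(x)` and the majorant `Λ(x) ≥ |S(x)w(x)|`.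
[cite: Miller2019, Thm 5.7 (proof: Lemma 5.6 and Thm 5.2, pp. 16–19)] -/
theorem Torus.exists_enstrophyFlux_le_of_strainDirection_Lq_le (hd : Fintype.card d = 3)
    {q ν : ℝ} (hq : 3 / 2 < q) (hν : 0 < ν) :
    ∃ K : ℝ, 0 ≤ K ∧ ∀ (v : UnitAddTorus d → EuclideanSpace ℝ d), Torus.IsSmooth v →
      Torus.IsDivFree v → ∀ (w : UnitAddTorus d → EuclideanSpace ℝ d), (∀ x, ‖w x‖ = 1) →
      ∀ (Λ : UnitAddTorus d → ℝ), Continuous Λ → (∀ x, 0 ≤ Λ x) →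
      (∀ x, Real.sqrt (∑ i, (∑ j,
        (Torus.partialDeriv j v x i + Torus.partialDeriv i v x j) / 2 * w x j) ^ 2) ≤ Λ x) →
      ∀ N : ℝ, 0 ≤ N → (∫ x, Λ x ^ q) ^ (1 / q) ≤ N →
        -ν * (∫ x, ‖Torus.laplacian v x‖ ^ 2) + ∫ x, ⟪Torus.convect v v x, Torus.laplacian v x⟫ ≤
          K * N ^ (2 * q / (2 * q - 3)) * Torus.gradNormSq v := by
  obtain ⟨K, hK0, hK⟩ := Torus.exists_enstrophyFlux_le_of_detStrain_majorant_Lq_le (d := d) hd hq hν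
  exact ⟨K, hK0, fun v hv hdiv w hw Λ hΛc hΛ0 hΛ N hN0 hN =>
    hK v hv hdiv Λ hΛc hΛ0
      (fun x => Torus.neg_four_mul_det_strain_le_direction_majorant hd (v := v) x (hw x) (hΛ x))
      N hN0 hN⟩

/-! ## §5 Miller's Theorem 1.3 / Cor 5.8 with a fixed direction, continuation form -/

/-- **Blow-up requires the strain to blow up in every (fixed) direction — Miller, ARMA 235 (2020),
Thm 1.3 = Thm 5.7 with `v ≡ e_k`, equivalently Cor 5.8 for one fixed direction:
`∫₀^{T_max}‖∂ₖu + ∇uₖ‖^p_{L^q} dt = +∞` if `T_max < ∞`, `2/p + 3/q = 2`, `3/2 < q < ∞`**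
(continuation form on `T³`). Let `(u, p)` be a classical solution of the unforced Navier–Stokes
equations with `ν > 0` on `[0, T) × T^d`, `card d = 3`, `T > 0`, with mean-zero velocity slices;
fix an index `k` and let `N` be a continuous nonnegative function on `[0, T)` with
`‖S(t)e_k‖_{L^q} = (∫ (∑ᵢ (½((∂ₖu)ᵢ + (∂ᵢu)ₖ))²)^{q/2})^{1/q} ≤ N(t)` and `∫₀ᵗ N^{2q/(2q−3)} ≤ I`
for all `t ∈ [0, T)`. Then the solution continues to a classical solution with mean-zero slices
on some `[0, T'] × T^d`, `T' > T`, equal to `u` on `[0, T)` (flux bound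
`Torus.exists_enstrophyFlux_le_of_strainColumn_Lq_le` + the Grönwall door
`Torus.classicalNS_continuation_of_enstrophyFlux_le`). Since `S e_k = ½(∂ₖu + ∇uₖ)`, this is the
criterion "`∂ₖu + ∇uₖ ∈ L^p(0,T; L^q)`" of the display after Cor 5.8, which "significantly
extends the range of exponents" of Kukavica–Ziane's `∂₃u` criterion (`9/4 ≤ q ≤ 3`).
[cite: Miller2019, Thm 1.3 (= Thm 5.7) and Cor 5.8 (fixed direction), case 3/2 < q < ∞] -/
theorem Torus.classicalNS_continuation_of_strainColumn_Lq_rpow_integral_le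
    (hd : Fintype.card d = 3) {ν T q : ℝ} (hν : 0 < ν) (hT : 0 < T) (hq : 3 / 2 < q)
    {u : ℝ → UnitAddTorus d → EuclideanSpace ℝ d} {p : ℝ → UnitAddTorus d → ℝ}
    (h : Torus.IsClassicalNSSolutionOn (Ico 0 T) ν 0 u p)
    (hmean : ∀ t ∈ Ico 0 T, Torus.HasZeroMean (u t)) (k : d)
    {N : ℝ → ℝ} (hNc : ContinuousOn N (Ico 0 T)) (hN0 : ∀ t ∈ Ico 0 T, 0 ≤ N t)
    (hN : ∀ t ∈ Ico 0 T, (∫ x, Real.sqrt (∑ i,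
      ((Torus.partialDeriv k (u t) x i + Torus.partialDeriv i (u t) x k) / 2) ^ 2) ^ q) ^ (1 / q) ≤
        N t)
    {I : ℝ} (hI : ∀ t ∈ Ico 0 T, ∫ τ in (0 : ℝ)..t, N τ ^ (2 * q / (2 * q - 3)) ≤ I) :
    ∃ T' : ℝ, T < T' ∧ ∃ (u' : ℝ → UnitAddTorus d → EuclideanSpace ℝ d)
      (p' : ℝ → UnitAddTorus d → ℝ), Torus.IsClassicalNSSolutionOn (Icc 0 T') ν 0 u' p' ∧
        (∀ t ∈ Icc 0 T', Torus.HasZeroMean (u' t)) ∧ ∀ t ∈ Ico 0 T, u' t = u t := by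
  obtain ⟨K, hK0, hK⟩ := Torus.exists_enstrophyFlux_le_of_strainColumn_Lq_le (d := d) hd hq hν
  have h2q3 : 0 < 2 * q - 3 := by linarith
  have hr0 : 0 ≤ 2 * q / (2 * q - 3) := by positivity
  refine Torus.classicalNS_continuation_of_enstrophyFlux_le hd hν hT h hmean
    (g := fun t => 2 * K * N t ^ (2 * q / (2 * q - 3)))
    (continuousOn_const.mul (hNc.rpow_const fun t _ => Or.inr hr0)) (fun t ht => ?_)
    (I := 2 * K * I) (fun t ht => ?_)
  · have hut : Torus.IsSmooth (u t) := h.smooth_velocity.isSmooth_slice ht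
    have hΛc : Continuous fun x => Real.sqrt (∑ i,
        ((Torus.partialDeriv k (u t) x i + Torus.partialDeriv i (u t) x k) / 2) ^ 2) :=
      Real.continuous_sqrt.comp (continuous_finsetSum _ fun i _ =>
        ((((hut.partialDeriv k).apply i).continuous.add
          ((hut.partialDeriv i).apply k).continuous).div_const _).pow 2)
    have h1 := hK (u t) hut (h.divFree t ht) k _ hΛc (fun x => Real.sqrt_nonneg _)
      (fun x => le_rfl) (N t) (hN0 t ht) (hN t ht)
    have h2 : K * N t ^ (2 * q / (2 * q - 3)) * Torus.gradNormSq (u t) =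
        2 * K * N t ^ (2 * q / (2 * q - 3)) * (2⁻¹ * Torus.gradNormSq (u t)) := by ring
    linarith
  · rw [intervalIntegral.integral_const_mul]
    exact mul_le_mul_of_nonneg_left (hI t ht) (by positivity)

/-- **Blow-up requires the strain to blow up in every direction — Miller, ARMA 235 (2020), Thm 1.3
= Thm 5.7, direction-field form** (continuation form on `T³`): "let `v ∈ L^∞(ℝ³ × [0, T_max]; ℝ³)`
with `|v(x,t)| = 1` almost everywhere. If `2/p + 3/q = 2` with `3/2 < q ≤ +∞`, then
`‖u(T)‖²_{Ḣ¹} ≤ (‖u⁰‖²_{Ḣ¹} + ∫₀ᵀ‖f‖²) exp(C_q ∫₀ᵀ ‖S(·,t)v(·,t)‖^p_{L^q} dt)`. In particular if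
`T_max < T^*` then `∫₀^{T_max}‖S(·,t)v(·,t)‖^p_{L^q} dt = +∞`." Here: `(u, p)` a classical mean-zero
solution of the unforced equations (`ν > 0`) on `[0, T) × T^d`, `card d = 3`; `w(t, x)` ANY
field of unit vectors; `Λ(t, ·)` continuous nonnegative majorants of `|S(t,x)w(t,x)|`
(`= √(∑ᵢ(∑ⱼ Sᵢⱼwⱼ)²)`); `N` continuous with `(∫Λ(t)^q)^{1/q} ≤ N(t)` and `∫₀ᵗ N^{2q/(2q−3)} ≤ I`
on `[0, T)`, `3/2 < q < ∞` ⇒ continuation past `T` (so a blow-up at `T` forces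
`∫₀ᵀ ‖S w‖^p_{L^q} = ∞` for EVERY direction field `w`; Cor 5.8's partition form
`w = ∑ₙ v_n(t) 1_{Ω_n(t)}` is the case of a piecewise constant field).
[cite: Miller2019, Thm 1.3 (= Thm 5.7), case 3/2 < q < ∞] -/
theorem Torus.classicalNS_continuation_of_strainDirection_Lq_rpow_integral_le
    (hd : Fintype.card d = 3) {ν T q : ℝ} (hν : 0 < ν) (hT : 0 < T) (hq : 3 / 2 < q)
    {u : ℝ → UnitAddTorus d → EuclideanSpace ℝ d} {p : ℝ → UnitAddTorus d → ℝ}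
    (h : Torus.IsClassicalNSSolutionOn (Ico 0 T) ν 0 u p)
    (hmean : ∀ t ∈ Ico 0 T, Torus.HasZeroMean (u t))
    {w : ℝ → UnitAddTorus d → EuclideanSpace ℝ d} (hw : ∀ t ∈ Ico 0 T, ∀ x, ‖w t x‖ = 1)
    {Λ : ℝ → UnitAddTorus d → ℝ} (hΛc : ∀ t ∈ Ico 0 T, Continuous (Λ t))
    (hΛ0 : ∀ t ∈ Ico 0 T, ∀ x, 0 ≤ Λ t x)
    (hΛ : ∀ t ∈ Ico 0 T, ∀ x, Real.sqrt (∑ i, (∑ j,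
      (Torus.partialDeriv j (u t) x i + Torus.partialDeriv i (u t) x j) / 2 * w t x j) ^ 2) ≤ Λ t x)
    {N : ℝ → ℝ} (hNc : ContinuousOn N (Ico 0 T)) (hN0 : ∀ t ∈ Ico 0 T, 0 ≤ N t)
    (hN : ∀ t ∈ Ico 0 T, (∫ x, Λ t x ^ q) ^ (1 / q) ≤ N t)
    {I : ℝ} (hI : ∀ t ∈ Ico 0 T, ∫ τ in (0 : ℝ)..t, N τ ^ (2 * q / (2 * q - 3)) ≤ I) :
    ∃ T' : ℝ, T < T' ∧ ∃ (u' : ℝ → UnitAddTorus d → EuclideanSpace ℝ d)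
      (p' : ℝ → UnitAddTorus d → ℝ), Torus.IsClassicalNSSolutionOn (Icc 0 T') ν 0 u' p' ∧
        (∀ t ∈ Icc 0 T', Torus.HasZeroMean (u' t)) ∧ ∀ t ∈ Ico 0 T, u' t = u t := by
  obtain ⟨K, hK0, hK⟩ := Torus.exists_enstrophyFlux_le_of_strainDirection_Lq_le (d := d) hd hq hν
  have h2q3 : 0 < 2 * q - 3 := by linarith
  have hr0 : 0 ≤ 2 * q / (2 * q - 3) := by positivity
  refine Torus.classicalNS_continuation_of_enstrophyFlux_le hd hν hT h hmean
    (g := fun t => 2 * K * N t ^ (2 * q / (2 * q - 3)))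
    (continuousOn_const.mul (hNc.rpow_const fun t _ => Or.inr hr0)) (fun t ht => ?_)
    (I := 2 * K * I) (fun t ht => ?_)
  · have hut : Torus.IsSmooth (u t) := h.smooth_velocity.isSmooth_slice ht
    have h1 := hK (u t) hut (h.divFree t ht) (w t) (hw t ht) (Λ t) (hΛc t ht) (hΛ0 t ht)
      (hΛ t ht) (N t) (hN0 t ht) (hN t ht)
    have h2 : K * N t ^ (2 * q / (2 * q - 3)) * Torus.gradNormSq (u t) =
        2 * K * N t ^ (2 * q / (2 * q - 3)) * (2⁻¹ * Torus.gradNormSq (u t)) := by ring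
    linarith
  · rw [intervalIntegral.integral_const_mul]
    exact mul_le_mul_of_nonneg_left (hI t ht) (by positivity)

/-! ## §6 Calderón–Zygmund: the third strain column is controlled by the horizontal vorticity -/

namespace BDSV

open FunctionSpaces FunctionSpaces.Torus

variable {u : UnitAddTorus (Fin 3) → EuclideanSpace ℝ (Fin 3)}

/-- Biot–Savart on `𝕋³` for divergence-free fields: `u - ∫u = -curl Δ⁻¹(curl u)`
(`Δ⁻¹Δu = u - ∫u`, `Δu = -curl curl u`, `Δ⁻¹ curl = curl Δ⁻¹`). [folklore] -/
private theorem sub_integral_eq_neg_curl_invLaplacian_curlH (hu : IsSmooth u) (hdiv : IsDivFree u)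
    (x : UnitAddTorus (Fin 3)) :
    u x - ∫ y, u y = -curl (invLaplacian (curl u)) x := by
  have hlap : Torus.laplacian u = fun y => -curl (curl u) y := by
    funext y
    rw [curl_curl_of_isDivFree hu hdiv y, neg_neg]
  rw [← invLaplacian_laplacian hu x, hlap, ← invLaplacian_curl (isSmooth_curl hu) x]
  have hneg : (fun y => -curl (curl u) y) = -curl (curl u) := rfl
  rw [hneg, invLaplacian_neg (isSmooth_curl (isSmooth_curl hu))]
  rfl

/-- The velocity gradient through the vorticity: `∂ⱼu(x)ᵢ = -(curl (∂ⱼ Δ⁻¹ curl u)(x))ᵢ` for smooth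
divergence-free `u` (differentiate `u - ∫u = -curl Δ⁻¹ curl u`; `∂ⱼ` commutes with `curl`). [folklore] -/
private theorem partialDeriv_apply_eq_neg_curlH (hu : IsSmooth u) (hdiv : IsDivFree u) (j i : Fin 3)
    (x : UnitAddTorus (Fin 3)) :
    Torus.partialDeriv j u x i = -(curl (Torus.partialDeriv j (invLaplacian (curl u))) x i) := by
  have hW : IsSmooth (invLaplacian (curl u)) := isSmooth_invLaplacian (isSmooth_curl hu)
  have hsub : Torus.partialDeriv j (fun y => u y - ∫ z, u z) x = Torus.partialDeriv j u x := by
    simp only [Torus.partialDeriv, Torus.lineDeriv, deriv_sub_const]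
  have hfun : (fun y => u y - ∫ z, u z) = fun y => -curl (invLaplacian (curl u)) y := by
    funext y
    exact sub_integral_eq_neg_curl_invLaplacian_curlH hu hdiv y
  rw [← hsub, hfun, partialDeriv_neg, partialDeriv_curl hW j x]
  rfl

/-- `Δ⁻¹` acts componentwise: `(Δ⁻¹Z)_b = Δ⁻¹(Z_b)`. [folklore] -/
private theorem invLaplacian_apply_coordH {Z : UnitAddTorus (Fin 3) → EuclideanSpace ℝ (Fin 3)}
    (hZ : IsSmooth Z) (b : Fin 3) :
    (fun y => invLaplacian Z y b) = invLaplacian (fun y => Z y b) := by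
  have h2 : (fun y => Z y b) = (EuclideanSpace.proj b : EuclideanSpace ℝ (Fin 3) →L[ℝ] ℝ) ∘ Z := rfl
  rw [h2, invLaplacian_clm_comp hZ]
  rfl

/-- The Hessian entries of the vector potential are Hessians of scalar potentials:
`(∂ₐ∂ⱼ Δ⁻¹ω)(x)_b = ∂ₐ∂ⱼ(Δ⁻¹ω_b)(x)`. [folklore] -/
private theorem hessian_component_eqH (hu : IsSmooth u) (j a b : Fin 3) :
    (fun x => Torus.partialDeriv a (Torus.partialDeriv j (invLaplacian (curl u))) x b) =
      Torus.partialDeriv a (Torus.partialDeriv j (invLaplacian (fun y => curl u y b))) := by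
  have hω : IsSmooth (curl u) := isSmooth_curl hu
  have hW : IsSmooth (invLaplacian (curl u)) := isSmooth_invLaplacian hω
  funext x
  rw [← partialDeriv_apply_coord ((hW.partialDeriv j).isContDiff (by simp)) a x b]
  congr 1
  funext y
  rw [← partialDeriv_apply_coord (hW.isContDiff (by simp)) j y b, invLaplacian_apply_coordH hω b]

/-- The vorticity components have zero mean: `∫ (curl u)_b = 0` (each is a difference of partial
derivatives of components of `u`). [folklore] -/
private theorem integral_curl_applyH (hu : IsSmooth u) (b : Fin 3) : ∫ y, curl u y b = 0 := by
  have hint : ∀ j k : Fin 3, ∫ y, Torus.partialDeriv j u y k = 0 := fun j k => by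
    have h := integral_partialDeriv_eq_zero_holds (hu.apply k) j
    simp_rw [partialDeriv_apply_coord (hu.isContDiff (by simp))] at h
    exact h
  have hI : ∀ j k : Fin 3, Integrable (fun y => Torus.partialDeriv j u y k) volume := fun j k =>
    ((hu.partialDeriv j).apply k).integrable
  fin_cases b
  · show ∫ y, (Torus.partialDeriv 1 u y 2 - Torus.partialDeriv 2 u y 1) = 0
    rw [integral_sub (hI 1 2) (hI 2 1), hint, hint, sub_zero]
  · show ∫ y, (Torus.partialDeriv 2 u y 0 - Torus.partialDeriv 0 u y 2) = 0
    rw [integral_sub (hI 2 0) (hI 0 2), hint, hint, sub_zero]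
  · show ∫ y, (Torus.partialDeriv 0 u y 1 - Torus.partialDeriv 1 u y 0) = 0
    rw [integral_sub (hI 0 1) (hI 1 0), hint, hint, sub_zero]

/-- **The gradient of the vertical velocity is controlled by the horizontal vorticity in
`L^p(𝕋³)`, `1 < p < ∞`** (Miller, thesis 2020, Prop. 6.6, (6.30): `‖∇u₃‖_{L^q} ≤ B_q‖ω_h‖_{L^q}`;
Chae–Choe's mechanism): for every `1 < p < ∞` there is `C` with
`‖∂ⱼu₂‖_{L^p} ≤ C(‖ω₀‖_{L^p} + ‖ω₁‖_{L^p})` for all smooth divergence-free `u` on `𝕋³` and all `j`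
(`ω = curl u`, indices `0, 1, 2`). Proof: `∂ⱼu₂ = −(curl ∂ⱼΔ⁻¹ω)₂ = ∂₁∂ⱼΔ⁻¹ω₀ − ∂₀∂ⱼΔ⁻¹ω₁`
involves only `ω₀, ω₁`; each term is bounded by the periodic Hessian bound
`Torus.eLpNorm_hessian_le_laplacian_holds_fin3` (as in `exists_eLpNorm_partialDeriv_le_curl`).
[cite: MajdaBertozziCUP2002, §11.1 eq. (11.9) with Prop. 10.6] -/
theorem exists_eLpNorm_partialDeriv_vertical_le_horizontal_curl {p : ℝ≥0∞} (hp1 : 1 < p)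
    (hp : p < ⊤) :
    ∃ C : ℝ≥0, ∀ u : UnitAddTorus (Fin 3) → EuclideanSpace ℝ (Fin 3), IsSmooth u → IsDivFree u →
      ∀ j : Fin 3, eLpNorm (fun x => Torus.partialDeriv j u x 2) p volume ≤
        C * (eLpNorm (fun x => curl u x 0) p volume + eLpNorm (fun x => curl u x 1) p volume) := by
  obtain ⟨C, hC⟩ := eLpNorm_hessian_le_laplacian_holds_fin3 p hp1 hp
  refine ⟨C, fun u hu hdiv j => ?_⟩
  have hω : IsSmooth (curl u) := isSmooth_curl hu
  have hW : IsSmooth (invLaplacian (curl u)) := isSmooth_invLaplacian hω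
  -- the Hessian entries of the vector potential, `g a b = (∂ₐ∂ⱼΔ⁻¹ω)_b`
  set g : Fin 3 → Fin 3 → UnitAddTorus (Fin 3) → ℝ := fun a b x =>
    Torus.partialDeriv a (Torus.partialDeriv j (invLaplacian (curl u))) x b with hg
  have hg_meas : ∀ a b, AEStronglyMeasurable (g a b) volume := fun a b =>
    (((hW.partialDeriv j).partialDeriv a).apply b).continuous.aestronglyMeasurable
  -- Calderón–Zygmund bound of each entry by the corresponding vorticity component
  have hgb : ∀ a b, eLpNorm (g a b) p volume ≤ C * eLpNorm (fun x => curl u x b) p volume := by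
    intro a b
    have hωb : IsSmooth (fun y => curl u y b) := hω.apply b
    have hlap : Torus.laplacian (invLaplacian fun y => curl u y b) = fun y => curl u y b := by
      funext x
      rw [laplacian_invLaplacian hωb x, integral_curl_applyH hu b, sub_zero]
    have h1 := hC (invLaplacian fun y => curl u y b) (isSmooth_invLaplacian hωb) a j
    rw [hlap] at h1
    have hgeq : g a b =
        Torus.partialDeriv a (Torus.partialDeriv j (invLaplacian fun y => curl u y b)) :=
      hessian_component_eqH hu j a b
    rw [hgeq]
    exact h1
  have hfun : (fun x => Torus.partialDeriv j u x 2) = fun x => g 1 0 x - g 0 1 x := by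
    funext x
    rw [partialDeriv_apply_eq_neg_curlH hu hdiv j 2 x, curl_apply_two]
    simp only [hg]
    ring
  rw [hfun]
  calc eLpNorm (fun x => g 1 0 x - g 0 1 x) p volume
      = eLpNorm (g 1 0 - g 0 1) p volume := rfl
    _ ≤ eLpNorm (g 1 0) p volume + eLpNorm (g 0 1) p volume :=
        eLpNorm_sub_le (hg_meas 1 0) (hg_meas 0 1) hp1.le
    _ ≤ C * eLpNorm (fun x => curl u x 0) p volume + C * eLpNorm (fun x => curl u x 1) p volume :=
        add_le_add (hgb 1 0) (hgb 0 1)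
    _ = C * (eLpNorm (fun x => curl u x 0) p volume + eLpNorm (fun x => curl u x 1) p volume) := by
        rw [mul_add]

/-- **The third column of the strain is controlled by the horizontal vorticity in `L^p(𝕋³)`,
`1 < p < ∞`** (Miller, thesis 2020, Prop. 6.6: `‖∂₃u + ∇u₃‖_{L^q} ≤ 2B_q‖ω_h‖_{L^q}`, from the
pointwise identity (6.27) `∂₃u − ∇u₃ = (ω₂, −ω₁, 0)` and the Helmholtz bounds): for every
`1 < p < ∞` there is `C` with `‖(S e₂)ᵢ‖_{L^p} = ‖½((∂₂u)ᵢ + ∂ᵢu₂)‖_{L^p} ≤ C(‖ω₀‖_{L^p} + ‖ω₁‖_{L^p})`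
for all smooth divergence-free `u` on `𝕋³` and all `i` (pointwise
`|(S e₂)ᵢ| ≤ |ω₀| + |ω₁| + |∂ᵢu₂|`, then `exists_eLpNorm_partialDeriv_vertical_le_horizontal_curl`).
[cite: MajdaBertozziCUP2002, §11.1 eq. (11.9) with Prop. 10.6] -/
theorem exists_eLpNorm_strainColumn_le_horizontal_curl {p : ℝ≥0∞} (hp1 : 1 < p) (hp : p < ⊤) :
    ∃ C : ℝ≥0, ∀ u : UnitAddTorus (Fin 3) → EuclideanSpace ℝ (Fin 3), IsSmooth u → IsDivFree u →
      ∀ i : Fin 3, eLpNorm (fun x => (Torus.partialDeriv 2 u x i + Torus.partialDeriv i u x 2) / 2)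
        p volume ≤
        C * (eLpNorm (fun x => curl u x 0) p volume + eLpNorm (fun x => curl u x 1) p volume) := by
  obtain ⟨C, hC⟩ := exists_eLpNorm_partialDeriv_vertical_le_horizontal_curl hp1 hp
  refine ⟨1 + C, fun u hu hdiv i => ?_⟩
  set E : ℝ≥0∞ := eLpNorm (fun x => curl u x 0) p volume + eLpNorm (fun x => curl u x 1) p volume
    with hE
  -- pointwise majorant
  set G : UnitAddTorus (Fin 3) → ℝ := fun x =>
    ‖curl u x 0‖ + ‖curl u x 1‖ + ‖Torus.partialDeriv i u x 2‖ with hG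
  have hpt : ∀ x, ‖(Torus.partialDeriv 2 u x i + Torus.partialDeriv i u x 2) / 2‖ ≤ G x := by
    intro x
    have hε : ‖Torus.partialDeriv 2 u x i - Torus.partialDeriv i u x 2‖ ≤
        ‖curl u x 0‖ + ‖curl u x 1‖ := by
      fin_cases i
      · show ‖Torus.partialDeriv 2 u x 0 - Torus.partialDeriv 0 u x 2‖ ≤ ‖curl u x 0‖ + ‖curl u x 1‖
        have e : Torus.partialDeriv 2 u x 0 - Torus.partialDeriv 0 u x 2 = curl u x 1 := by
          rw [curl_apply_one]
        rw [e]
        linarith [norm_nonneg (curl u x 0)]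
      · show ‖Torus.partialDeriv 2 u x 1 - Torus.partialDeriv 1 u x 2‖ ≤ ‖curl u x 0‖ + ‖curl u x 1‖
        have e : Torus.partialDeriv 2 u x 1 - Torus.partialDeriv 1 u x 2 = -curl u x 0 := by
          rw [curl_apply_zero]; ring
        rw [e, norm_neg]
        linarith [norm_nonneg (curl u x 1)]
      · show ‖Torus.partialDeriv 2 u x 2 - Torus.partialDeriv 2 u x 2‖ ≤ ‖curl u x 0‖ + ‖curl u x 1‖
        rw [sub_self, norm_zero]
        positivity
    have e2 : (Torus.partialDeriv 2 u x i + Torus.partialDeriv i u x 2) / 2 =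
        (Torus.partialDeriv 2 u x i - Torus.partialDeriv i u x 2) / 2 + Torus.partialDeriv i u x 2 := by
      ring
    rw [e2]
    calc ‖(Torus.partialDeriv 2 u x i - Torus.partialDeriv i u x 2) / 2 + Torus.partialDeriv i u x 2‖
        ≤ ‖(Torus.partialDeriv 2 u x i - Torus.partialDeriv i u x 2) / 2‖ + ‖Torus.partialDeriv i u x 2‖ :=
          norm_add_le _ _
      _ ≤ (‖curl u x 0‖ + ‖curl u x 1‖) + ‖Torus.partialDeriv i u x 2‖ := by
          refine add_le_add ?_ le_rfl
          rw [norm_div, Real.norm_two]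
          linarith [norm_nonneg (Torus.partialDeriv 2 u x i - Torus.partialDeriv i u x 2)]
      _ = G x := by rw [hG]
  have hG0 : ∀ x, 0 ≤ G x := fun x => by rw [hG]; positivity
  have hmono : eLpNorm (fun x => (Torus.partialDeriv 2 u x i + Torus.partialDeriv i u x 2) / 2) p volume ≤
      eLpNorm G p volume :=
    eLpNorm_mono_real hpt
  -- measurability
  have hω : IsSmooth (curl u) := isSmooth_curl hu
  have hm0 : AEStronglyMeasurable (fun x => ‖curl u x 0‖) volume :=
    (hω.apply 0).continuous.norm.aestronglyMeasurable
  have hm1 : AEStronglyMeasurable (fun x => ‖curl u x 1‖) volume :=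
    (hω.apply 1).continuous.norm.aestronglyMeasurable
  have hm2 : AEStronglyMeasurable (fun x => ‖Torus.partialDeriv i u x 2‖) volume :=
    ((hu.partialDeriv i).apply 2).continuous.norm.aestronglyMeasurable
  have hGle : eLpNorm G p volume ≤ E + eLpNorm (fun x => Torus.partialDeriv i u x 2) p volume := by
    have e1 : G = (fun x => ‖curl u x 0‖ + ‖curl u x 1‖) + fun x => ‖Torus.partialDeriv i u x 2‖ := by
      funext x; simp only [hG, Pi.add_apply]
    have e0 : (fun x => ‖curl u x 0‖ + ‖curl u x 1‖) =
        (fun x => ‖curl u x 0‖) + fun x => ‖curl u x 1‖ := by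
      funext x; simp only [Pi.add_apply]
    calc eLpNorm G p volume
        ≤ eLpNorm (fun x => ‖curl u x 0‖ + ‖curl u x 1‖) p volume +
            eLpNorm (fun x => ‖Torus.partialDeriv i u x 2‖) p volume := by
          rw [e1]; exact eLpNorm_add_le (hm0.add hm1) hm2 hp1.le
      _ ≤ (eLpNorm (fun x => ‖curl u x 0‖) p volume + eLpNorm (fun x => ‖curl u x 1‖) p volume) +
            eLpNorm (fun x => ‖Torus.partialDeriv i u x 2‖) p volume := by
          refine add_le_add ?_ le_rfl
          rw [e0]; exact eLpNorm_add_le hm0 hm1 hp1.le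
      _ = E + eLpNorm (fun x => Torus.partialDeriv i u x 2) p volume := by
          rw [hE, eLpNorm_norm, eLpNorm_norm, eLpNorm_norm]
  calc eLpNorm (fun x => (Torus.partialDeriv 2 u x i + Torus.partialDeriv i u x 2) / 2) p volume
      ≤ E + eLpNorm (fun x => Torus.partialDeriv i u x 2) p volume := hmono.trans hGle
    _ ≤ E + C * E := add_le_add le_rfl (hC u hu hdiv i)
    _ = ((1 + C : ℝ≥0) : ℝ≥0∞) * E := by push_cast; ring

end BDSV

/-! ## §7 Chae–Choe: two components of the vorticity, continuation form on `𝕋³` -/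

/-- `√(∑ aᵢ²) ≤ ∑ |aᵢ|`. [folklore] -/
private theorem sqrt_sum_sq_le_sum_abs {ι : Type*} [Fintype ι] (a : ι → ℝ) :
    Real.sqrt (∑ i, a i ^ 2) ≤ ∑ i, |a i| := by
  rw [Real.sqrt_le_left (Finset.sum_nonneg fun i _ => abs_nonneg _)]
  calc ∑ i, a i ^ 2 = ∑ i, |a i| ^ 2 := Finset.sum_congr rfl fun i _ => (sq_abs _).symm
    _ ≤ (∑ i, |a i|) ^ 2 :=
        Finset.sum_sq_le_sq_sum_of_nonneg fun i _ => abs_nonneg (a i)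

/-- The `L^q` norm of a continuous function on `𝕋³` as an `eLpNorm`. [folklore] -/
private theorem eLpNorm_eq_ofReal_rpow {g : UnitAddTorus (Fin 3) → ℝ} (hg : Continuous g) {q : ℝ}
    (hq : 0 < q) :
    eLpNorm g (ENNReal.ofReal q) volume = ENNReal.ofReal ((∫ x, |g x| ^ q) ^ (1 / q)) := by
  have hmem : MemLp g (ENNReal.ofReal q) volume :=
    hg.memLp_of_hasCompactSupport (HasCompactSupport.of_compactSpace g)
  rw [hmem.eLpNorm_eq_integral_rpow_norm (ENNReal.ofReal_pos.2 hq).ne' ENNReal.ofReal_ne_top,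
    ENNReal.toReal_ofReal hq.le, one_div]
  simp only [Real.norm_eq_abs]

/-- **Chae–Choe 1999, Theorem 1 (two components of the vorticity), on `𝕋³`, continuation form**
("If a Leray–Hopf weak solution `v` satisfies `ω̃ ∈ L^{α,γ}_T` with `2/α + 3/γ ≤ 2`,
`1 < α < ∞` and `3/2 < γ < ∞` … then `v` becomes the classical solution on `(0, T]`",
`ω̃ = ω₁e₁ + ω₂e₂`; Remark 1: "at finite blow-up time at least two components of the vortices
must simultaneously blow up"). Let `(u, p)` be a classical solution of the unforced Navier–Stokes
equations with `ν > 0` on `[0, T) × 𝕋³` (`𝕋³ = UnitAddTorus (Fin 3)`), `T > 0`, with mean-zero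
velocity slices; let `3/2 < q` and let `N` be a continuous nonnegative function on `[0, T)` with
`(∫|ωₗ(t)|^q)^{1/q} ≤ N(t)` for the two horizontal vorticity components `l = 0, 1`
(`ω = curl u`) and `∫₀ᵗ N^{2q/(2q−3)} ≤ I` for all `t ∈ [0, T)` (`α = 2q/(2q−3)`:
`2/α + 3/q = 2`). Then the solution continues to a classical solution with mean-zero slices on
some `[0, T'] × 𝕋³`, `T' > T`, equal to `u` on `[0, T)`. Proof (Miller's route, not the
Biot–Savart-kernel proof of Chae–Choe): `‖S(t)e₂‖_{L^q} ≤ C(‖ω₀(t)‖_{L^q} + ‖ω₁(t)‖_{L^q}) ≤ 2CN(t)`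
(`BDSV.exists_eLpNorm_strainColumn_le_horizontal_curl`), and
`Torus.classicalNS_continuation_of_strainColumn_Lq_rpow_integral_le` with `k = 2`.
[cite: ChaeChoe1999, Theorem 1 (case 3/2 < γ < ∞); proof route Miller2019, Cor 5.8 ff.] -/
theorem Torus.classicalNS_continuation_of_horizontalVorticity_Lq_rpow_integral_le
    {ν T q : ℝ} (hν : 0 < ν) (hT : 0 < T) (hq : 3 / 2 < q)
    {u : ℝ → UnitAddTorus (Fin 3) → EuclideanSpace ℝ (Fin 3)} {p : ℝ → UnitAddTorus (Fin 3) → ℝ}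
    (h : Torus.IsClassicalNSSolutionOn (Ico 0 T) ν 0 u p)
    (hmean : ∀ t ∈ Ico 0 T, Torus.HasZeroMean (u t))
    {N : ℝ → ℝ} (hNc : ContinuousOn N (Ico 0 T)) (hN0 : ∀ t ∈ Ico 0 T, 0 ≤ N t)
    (hN : ∀ t ∈ Ico 0 T, ∀ l : Fin 3, l ≠ 2 →
      (∫ x, |BDSV.curl (u t) x l| ^ q) ^ (1 / q) ≤ N t)
    {I : ℝ} (hI : ∀ t ∈ Ico 0 T, ∫ τ in (0 : ℝ)..t, N τ ^ (2 * q / (2 * q - 3)) ≤ I) :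
    ∃ T' : ℝ, T < T' ∧ ∃ (u' : ℝ → UnitAddTorus (Fin 3) → EuclideanSpace ℝ (Fin 3))
      (p' : ℝ → UnitAddTorus (Fin 3) → ℝ), Torus.IsClassicalNSSolutionOn (Icc 0 T') ν 0 u' p' ∧
        (∀ t ∈ Icc 0 T', Torus.HasZeroMean (u' t)) ∧ ∀ t ∈ Ico 0 T, u' t = u t := by
  have hq0 : 0 < q := by linarith
  have hq1 : (1 : ℝ≥0∞) < ENNReal.ofReal q := by
    rw [← ENNReal.ofReal_one]
    exact (ENNReal.ofReal_lt_ofReal_iff hq0).2 (by linarith)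
  obtain ⟨C, hC⟩ := BDSV.exists_eLpNorm_strainColumn_le_horizontal_curl hq1 ENNReal.ofReal_lt_top
  have h2q3 : 0 < 2 * q - 3 := by linarith
  have hr0 : 0 ≤ 2 * q / (2 * q - 3) := by positivity
  set c : ℝ := 6 * C with hc
  have hc0 : 0 ≤ c := by rw [hc]; positivity
  refine Torus.classicalNS_continuation_of_strainColumn_Lq_rpow_integral_le (d := Fin 3) (by simp)
    hν hT hq h hmean 2 (N := fun t => c * N t) (continuousOn_const.mul hNc)
    (fun t ht => mul_nonneg hc0 (hN0 t ht)) (fun t ht => ?_) (I := c ^ (2 * q / (2 * q - 3)) * I)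
    (fun t ht => ?_)
  · -- `‖S(t)e₂‖_{L^q} ≤ 6 C N(t)`
    have hut : Torus.IsSmooth (u t) := h.smooth_velocity.isSmooth_slice ht
    set a : Fin 3 → UnitAddTorus (Fin 3) → ℝ := fun i x =>
      (Torus.partialDeriv 2 (u t) x i + Torus.partialDeriv i (u t) x 2) / 2 with ha
    have hac : ∀ i, Continuous (a i) := fun i =>
      (((hut.partialDeriv 2).apply i).continuous.add ((hut.partialDeriv i).apply 2).continuous).div_const _
    set f : UnitAddTorus (Fin 3) → ℝ := fun x => Real.sqrt (∑ i, a i x ^ 2) with hf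
    have hfc : Continuous f := Real.continuous_sqrt.comp (continuous_finsetSum _ fun i _ => (hac i).pow 2)
    have hf0 : ∀ x, 0 ≤ f x := fun x => Real.sqrt_nonneg _
    -- `eLpNorm f ≤ ∑ᵢ eLpNorm aᵢ ≤ 3 C (E₀ + E₁)`
    set E : ℝ≥0∞ := eLpNorm (fun x => BDSV.curl (u t) x 0) (ENNReal.ofReal q) volume +
      eLpNorm (fun x => BDSV.curl (u t) x 1) (ENNReal.ofReal q) volume with hE
    have hai : ∀ i, eLpNorm (a i) (ENNReal.ofReal q) volume ≤ C * E := fun i =>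
      hC (u t) hut (h.divFree t ht) i
    have ham : ∀ i, AEStronglyMeasurable (fun x => |a i x|) volume := fun i =>
      (continuous_abs.comp (hac i)).aestronglyMeasurable
    have hfle : eLpNorm f (ENNReal.ofReal q) volume ≤ 3 * (C * E) := by
      have hpt : ∀ x, ‖f x‖ ≤ |a 0 x| + |a 1 x| + |a 2 x| := by
        intro x
        rw [Real.norm_of_nonneg (hf0 x)]
        have := sqrt_sum_sq_le_sum_abs (fun i => a i x)
        simpa only [Fin.sum_univ_three, hf] using this
      have e3 : (fun x => |a 0 x| + |a 1 x| + |a 2 x|) =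
          ((fun x => |a 0 x|) + fun x => |a 1 x|) + fun x => |a 2 x| := by
        funext x; simp only [Pi.add_apply]
      calc eLpNorm f (ENNReal.ofReal q) volume
          ≤ eLpNorm (fun x => |a 0 x| + |a 1 x| + |a 2 x|) (ENNReal.ofReal q) volume :=
            eLpNorm_mono_real hpt
        _ ≤ eLpNorm (fun x => |a 0 x|) (ENNReal.ofReal q) volume +
              eLpNorm (fun x => |a 1 x|) (ENNReal.ofReal q) volume +
              eLpNorm (fun x => |a 2 x|) (ENNReal.ofReal q) volume := by
            rw [e3]
            refine (eLpNorm_add_le ((ham 0).add (ham 1)) (ham 2) hq1.le).trans ?_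
            exact add_le_add (eLpNorm_add_le (ham 0) (ham 1) hq1.le) le_rfl
        _ = eLpNorm (a 0) (ENNReal.ofReal q) volume + eLpNorm (a 1) (ENNReal.ofReal q) volume +
              eLpNorm (a 2) (ENNReal.ofReal q) volume := by
            have e : ∀ i, eLpNorm (fun x => |a i x|) (ENNReal.ofReal q) volume =
                eLpNorm (a i) (ENNReal.ofReal q) volume := fun i => by
              rw [← eLpNorm_norm (a i)]
              simp only [Real.norm_eq_abs]
            rw [e, e, e]
        _ ≤ C * E + C * E + C * E := add_le_add (add_le_add (hai 0) (hai 1)) (hai 2)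
        _ = 3 * (C * E) := by ring
    -- the vorticity norms in terms of `N`
    have hEle : E ≤ ENNReal.ofReal (N t) + ENNReal.ofReal (N t) := by
      have hω : Torus.IsSmooth (BDSV.curl (u t)) := BDSV.isSmooth_curl hut
      have e : ∀ l, eLpNorm (fun x => BDSV.curl (u t) x l) (ENNReal.ofReal q) volume =
          ENNReal.ofReal ((∫ x, |BDSV.curl (u t) x l| ^ q) ^ (1 / q)) := fun l =>
        eLpNorm_eq_ofReal_rpow (hω.apply l).continuous hq0
      rw [hE, e, e]
      exact add_le_add (ENNReal.ofReal_le_ofReal (hN t ht 0 (by decide)))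
        (ENNReal.ofReal_le_ofReal (hN t ht 1 (by decide)))
    have hfin : eLpNorm f (ENNReal.ofReal q) volume ≤ ENNReal.ofReal (c * N t) := by
      refine hfle.trans ?_
      have hNt : 0 ≤ N t := hN0 t ht
      calc (3 : ℝ≥0∞) * (C * E) ≤ 3 * (C * (ENNReal.ofReal (N t) + ENNReal.ofReal (N t))) := by
            gcongr
        _ = ENNReal.ofReal (c * N t) := by
            rw [← ENNReal.ofReal_add hNt hNt, ← ENNReal.ofReal_coe_nnreal,
              ← ENNReal.ofReal_mul (NNReal.coe_nonneg C),
              show (3 : ℝ≥0∞) = ENNReal.ofReal 3 by norm_num,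
              ← ENNReal.ofReal_mul (by norm_num : (0 : ℝ) ≤ 3)]
            congr 1
            rw [hc]
            ring
    -- back to the Bochner form
    rw [eLpNorm_eq_ofReal_rpow hfc hq0] at hfin
    have hcN : 0 ≤ c * N t := mul_nonneg hc0 (hN0 t ht)
    have key := (ENNReal.ofReal_le_ofReal_iff hcN).1 hfin
    have eabs : (∫ x, |f x| ^ q) = ∫ x, f x ^ q :=
      integral_congr_ae (ae_of_all _ fun x => by simp only [abs_of_nonneg (hf0 x)])
    rw [eabs] at key
    simpa only [hf, ha] using key
  · -- the primitive of `(c N)^{2q/(2q−3)}`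
    have e : ∀ τ ∈ Set.uIcc (0 : ℝ) t, (c * N τ) ^ (2 * q / (2 * q - 3)) =
        c ^ (2 * q / (2 * q - 3)) * N τ ^ (2 * q / (2 * q - 3)) := by
      intro τ hτ
      have hτ' : τ ∈ Ico 0 T := by
        rw [Set.uIcc_of_le ht.1] at hτ
        exact ⟨hτ.1, hτ.2.trans_lt ht.2⟩
      exact Real.mul_rpow hc0 (hN0 τ hτ')
    rw [intervalIntegral.integral_congr e, intervalIntegral.integral_const_mul]
    exact mul_le_mul_of_nonneg_left (hI t ht) (by positivity)

end Literature.Analysis.FluidPDE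

end
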